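import Literature.NumberTheory.DiophantineGeometry.SumsOfUnitsCubeProofs
import Mathlib.RingTheory.Radical.NatInt
import Mathlib.Analysis.Complex.ExponentialBounds
import HarnessLib

/-!
# von Känel–Matschke, Corollary L (coprime `m, n` with `m + n` a square or a cube) from the §10 roots (proofs)

Topic `Literature/NumberTheory/DiophantineGeometry` (family `abc`). A proofs-only companion (theorems only; NO
definition, NO new named fact; D-0014, D-0026) of `MordellThueRamanujanNagellHeightBounds.lean`, where
**Corollary L** (§1.2.3) of R. von Känel, B. Matschke, arXiv:1605.06079 = Mem. AMS 286 (2023) [`VonkanelMatschke2023`]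
is typed as `corollary_L`: *"Suppose that `m` and `n` are arbitrary coprime rational integers. If condition `(*)`
[the natural logarithm of `|m|` or `|n|` exceeds `(90r)² log(9r)`, `r = rad(mn)`] holds, then `m + n` is not a
perfect square or cube."*

## The printed proof (§9) and how it is followed

*"We now suppose that `m, n ∈ ℤ` are coprime. Then `gcd(m, n)` is in particular square-free and cube-free, and
`m, n` are in `𝒪^×` for `S = {p : p ∣ mn}` with `N_S = rad(mn)`. Therefore (claimsquare) and (claimcube) imply
Corollary L stated in the introduction."* — `corollary_L_of_claims` applies `claimsquare` / `claimcube`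
(`SumsOfUnitsSquareProofs`, `SumsOfUnitsCubeProofs`; bound `Ω' = 3Ω_sim(1, S) + 9 log N_S`) with
`S = {p ∣ mn}`, `N_S = rad(mn) = r`, `1_S = 1728 r²`, and the numerical inequality
`3Ω_sim(1, S) + 9 log r = (4/3)A log A + (1/2)A log₃A + (6/5)A + 9 log r ≤ (90r)² log(9r)` for `A = 1728r²`,
`r ≥ 2` (`numeric_corollary_L`; `log 1728 ≤ 7.4548`, `log log A ≤ log(7.4548 + 2 log r) ≤ 2.01 + 2 log r/7.4548`,
`log x ≤ x/e`, `log 9 ≥ 2.1972`; the margin at `r = 2` is about `1%`). The degenerate cases `mn = 0`, `|mn| = 1`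
contradict `(*)` directly.

## Main result

`corollary_L_of_roots (hmod) (h103) (hi) : corollary_L` — from {modularity, Lemma 10.3, Prop. 10.8 (i)}. No `abc`
claim; axioms standard.
-/

noncomputable section

open Height
open Literature.NumberTheory.EllipticCurves.ModularForms

namespace Literature.NumberTheory.DiophantineGeometry

namespace VonKanelMatschke

/-! ### The numerical inequality -/

/-- `log 1728 ≤ 7.4548` (`1728 = 2⁶ 3³`). [folklore] -/
private theorem log_1728_le_sharp : Real.log 1728 ≤ 7.4548 := by
  have h2 := Real.log_two_lt_d9
  have h3 := Real.log_three_lt_d9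
  have : Real.log 1728 = 6 * Real.log 2 + 3 * Real.log 3 := by
    rw [show (1728 : ℝ) = 2 ^ 6 * 3 ^ 3 by norm_num, Real.log_mul (by norm_num) (by norm_num),
      Real.log_pow, Real.log_pow]; push_cast; ring
  rw [this]; linarith

/-- `log 1728 ≥ 7.4546` (`1728 = 2⁶ 3³`). [folklore] -/
private theorem log_1728_ge_sharp : 7.4546 ≤ Real.log 1728 := by
  have h2 := Real.log_two_gt_d9
  have h3 := Real.log_three_gt_d9
  have : Real.log 1728 = 6 * Real.log 2 + 3 * Real.log 3 := by
    rw [show (1728 : ℝ) = 2 ^ 6 * 3 ^ 3 by norm_num, Real.log_mul (by norm_num) (by norm_num),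
      Real.log_pow, Real.log_pow]; push_cast; ring
  rw [this]; linarith

/-- `log 7.4548 ≤ 2.01` (`e² · e^{0.01} ≥ 7.389 · 1.01`). [folklore] -/
private theorem log_74548_le : Real.log 7.4548 ≤ 2.01 := by
  have he := Real.exp_one_gt_d9
  rw [Real.log_le_iff_le_exp (by norm_num)]
  have h1 : Real.exp 2.01 = Real.exp 1 * Real.exp 1 * Real.exp 0.01 := by
    rw [← Real.exp_add, ← Real.exp_add]; norm_num
  have h2 : (0.01 : ℝ) + 1 ≤ Real.exp 0.01 := Real.add_one_le_exp _
  have h3 : 0 < Real.exp 1 := Real.exp_pos 1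
  rw [h1]; nlinarith [mul_le_mul he.le he.le (by norm_num) h3.le]

/-- `log x ≤ x / e` for `x > 0`. [folklore] -/
private theorem log_le_div_exp_one {x : ℝ} (hx : 0 < x) : Real.log x ≤ x / Real.exp 1 := by
  have h := Real.log_le_sub_one_of_pos (div_pos hx (Real.exp_pos 1))
  rw [Real.log_div hx.ne' (Real.exp_pos 1).ne', Real.log_exp] at h
  linarith

/-- `log(a + b) ≤ log a + b/a` for `a > 0`, `b ≥ 0`. [folklore] -/
private theorem log_add_le_add_div' {a b : ℝ} (ha : 0 < a) (hb : 0 ≤ b) :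
    Real.log (a + b) ≤ Real.log a + b / a := by
  have h1 : Real.log (a + b) - Real.log a = Real.log ((a + b) / a) := (Real.log_div (by positivity) ha.ne').symm
  have h2 : Real.log ((a + b) / a) ≤ (a + b) / a - 1 := Real.log_le_sub_one_of_pos (by positivity)
  have h3 : (a + b) / a - 1 = b / a := by field_simp; ring
  linarith

/-- **The numerical inequality behind Corollary L**: for `r ≥ 2` and `A = 1728 r²`,
`(4/3)A log A + (1/2)A log log log A + (6/5)A + 9 log r ≤ (90 r)² log(9 r)`.
[cite: VonkanelMatschke2023, §9 (proof of Corollary L: (claimsquare), (claimcube) with N_S = rad(mn))] -/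
theorem numeric_corollary_L {r : ℝ} (hr : 2 ≤ r) :
    4 / 3 * (1728 * r ^ 2) * Real.log (1728 * r ^ 2) +
        1 / 2 * (1728 * r ^ 2) * Real.log (Real.log (Real.log (1728 * r ^ 2))) +
        6 / 5 * (1728 * r ^ 2) + 9 * Real.log r ≤
      (90 * r) ^ 2 * Real.log (9 * r) := by
  have hl2 := Real.log_two_gt_d9
  have hl3 := Real.log_three_gt_d9
  have he := Real.exp_one_gt_d9
  have h1728 := log_1728_le_sharp
  have hr0 : 0 < r := by linarith
  have hlogr : 0.6931471803 ≤ Real.log r := hl2.le.trans (Real.log_le_log (by norm_num) hr)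
  set L : ℝ := Real.log r with hL
  -- `log A = log 1728 + 2 log r`
  have hlogA : Real.log (1728 * r ^ 2) = Real.log 1728 + 2 * L := by
    rw [Real.log_mul (by norm_num) (by positivity), Real.log_pow]; push_cast; ring
  have hΛ : Real.log (1728 * r ^ 2) ≤ 7.4548 + 2 * L := by rw [hlogA]; linarith
  have hΛge : 8.8 ≤ Real.log (1728 * r ^ 2) := by rw [hlogA]; linarith [log_1728_ge_sharp]
  have hΛpos : 1 < Real.log (1728 * r ^ 2) := by linarith
  -- `log log A ≤ 2.01 + 2 L / 7.4548`
  have hll : Real.log (Real.log (1728 * r ^ 2)) ≤ 2.01 + 2 * L / 7.4548 := by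
    have s1 : Real.log (Real.log (1728 * r ^ 2)) ≤ Real.log (7.4548 + 2 * L) :=
      Real.log_le_log (by linarith) hΛ
    have s2 := log_add_le_add_div' (a := 7.4548) (b := 2 * L) (by norm_num) (by linarith)
    linarith [log_74548_le]
  have hllpos : 0 < Real.log (Real.log (1728 * r ^ 2)) := Real.log_pos hΛpos
  -- `log₃ A ≤ (log log A)/e ≤ 0.73944 + 0.0988 L`
  have hll' : Real.log (Real.log (1728 * r ^ 2)) ≤ 2.01 + 0.2683 * L := by
    have : 2 * L / 7.4548 ≤ 0.2683 * L := by
      rw [div_le_iff₀ (by norm_num)]; nlinarith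
    linarith
  have hll1 : 1 ≤ Real.log (Real.log (1728 * r ^ 2)) := by
    rw [Real.le_log_iff_exp_le (by linarith)]; linarith [Real.exp_one_lt_d9]
  have hl3A : Real.log (Real.log (Real.log (1728 * r ^ 2))) ≤ 0.73944 + 0.0988 * L := by
    have s1 := (le_div_iff₀ (Real.exp_pos 1)).mp (log_le_div_exp_one hllpos)
    have s0 : 0 ≤ Real.log (Real.log (Real.log (1728 * r ^ 2))) := Real.log_nonneg hll1
    have s2 : Real.log (Real.log (Real.log (1728 * r ^ 2))) * 2.7182818283 ≤
        Real.log (Real.log (Real.log (1728 * r ^ 2))) * Real.exp 1 :=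
      mul_le_mul_of_nonneg_left he.le s0
    linarith
  -- the right-hand side
  have hRHS : (90 * r) ^ 2 * Real.log (9 * r) = 8100 * r ^ 2 * (2 * Real.log 3 + L) := by
    rw [Real.log_mul (by norm_num) hr0.ne', show (9 : ℝ) = 3 ^ 2 by norm_num, Real.log_pow]; push_cast; ring
  rw [hRHS]
  -- products
  have hr2 : 4 ≤ r ^ 2 := by nlinarith
  have P1 : 1728 * r ^ 2 * Real.log (1728 * r ^ 2) ≤ 1728 * r ^ 2 * (7.4548 + 2 * L) :=
    mul_le_mul_of_nonneg_left hΛ (by positivity)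
  have P2 : 1728 * r ^ 2 * Real.log (Real.log (Real.log (1728 * r ^ 2))) ≤
      1728 * r ^ 2 * (0.73944 + 0.0988 * L) := mul_le_mul_of_nonneg_left hl3A (by positivity)
  have P3 : 9 * L ≤ 9 * (r ^ 2 * L) := by nlinarith
  have P4 : 0.6931471803 * r ^ 2 ≤ r ^ 2 * L := by nlinarith
  nlinarith [P1, P2, P3, P4, hr2]

/-! ### Corollary L -/

/-- `a_S`-level of `1`: `1_S = 1728 N_S²`. [cite: VonkanelMatschke2023, §1.2.1 (def:asr2), a = 1] -/
theorem mordellLevel_one (S : Finset ℕ) : mordellLevel S 1 = 1728 * primesProd S ^ 2 := by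
  rw [mordellLevel_def]; simp

/-- **vKM Corollary L ⟸ {(claimsquare), (claimcube)}**, i.e. from Cor. 9.1 (sim) and Prop. 10.1, following the
printed proof (`S = {p ∣ mn}`, `N_S = rad(mn)`, coprimality gives a square-free and cube-free gcd) together with the
numerical comparison `numeric_corollary_L` of `Ω' = 3Ω_sim(1, S) + 9 log N_S` with `(90r)² log(9r)`.
[cite: VonkanelMatschke2023, Corollary L (§1.2.3; proof in §9)] -/
theorem corollary_L_of_claims (h91 : corollary_9_1_sim) (hMo : mordell_height_le) : corollary_L := by
  intro m n hcop hhyp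
  classical
  set R : ℕ := UniqueFactorizationMonoid.radical (m * n).natAbs with hRdef
  set r : ℝ := ((R : ℕ) : ℝ) with hrdef
  have hR1 : 1 ≤ R := Nat.radical_pos _
  have hr1 : (1 : ℝ) ≤ r := by rw [hrdef]; exact_mod_cast hR1
  have hlog9r : 0 < Real.log (9 * r) := Real.log_pos (by linarith)
  have hbound0 : 0 < (90 * r) ^ 2 * Real.log (9 * r) := by positivity
  -- the hypothesis forces `|m| ≥ 2` or `|n| ≥ 2`; with coprimality `m, n ≠ 0`
  have habs : ∀ t : ℤ, (90 * r) ^ 2 * Real.log (9 * r) < Real.log |(t : ℝ)| → 2 ≤ t.natAbs := by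
    intro t ht
    by_contra hlt
    have h1 : |(t : ℝ)| ≤ 1 := by
      have e : ((t.natAbs : ℕ) : ℝ) = |(t : ℝ)| := by rw [Nat.cast_natAbs, Int.cast_abs]
      rw [← e]
      have : t.natAbs ≤ 1 := by omega
      exact_mod_cast this
    have h2 : Real.log |(t : ℝ)| ≤ 0 := Real.log_nonpos (abs_nonneg _) h1
    linarith
  have hunit : ∀ a b : ℤ, IsCoprime a b → b = 0 → a.natAbs = 1 := by
    intro a b h hb
    subst hb
    exact Int.isUnit_iff_natAbs_eq.mp (isCoprime_zero_right.mp h)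
  have hmn : m ≠ 0 ∧ n ≠ 0 := by
    rcases hhyp with h | h
    · have h2 := habs m h
      refine ⟨fun h0 => by rw [h0] at h2; norm_num at h2, fun h0 => ?_⟩
      have := hunit m n hcop h0; omega
    · have h2 := habs n h
      refine ⟨fun h0 => ?_, fun h0 => by rw [h0] at h2; norm_num at h2⟩
      have := hunit n m hcop.symm h0; omega
  obtain ⟨hm0, hn0⟩ := hmn
  have hmn0 : (m * n).natAbs ≠ 0 := Int.natAbs_ne_zero.mpr (mul_ne_zero hm0 hn0)
  -- `r ≥ 2`
  have hR2 : 2 ≤ R := by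
    rw [hRdef, Nat.two_le_radical_iff]
    rcases hhyp with h | h
    · have h2 := habs m h
      rw [Int.natAbs_mul]
      exact le_trans h2 (Nat.le_mul_of_pos_right _ (Int.natAbs_pos.mpr hn0))
    · have h2 := habs n h
      rw [Int.natAbs_mul]
      exact le_trans h2 (Nat.le_mul_of_pos_left _ (Int.natAbs_pos.mpr hm0))
  have hr2 : (2 : ℝ) ≤ r := by rw [hrdef]; exact_mod_cast hR2
  -- `S = {p ∣ mn}`, `N_S = rad(mn) = R`, `m, n ∈ 𝒪^×`
  set S : Finset ℕ := (m * n).natAbs.primeFactors with hSdef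
  have hS : ∀ p ∈ S, p.Prime := fun p hp => Nat.prime_of_mem_primeFactors hp
  have hNS : primesProd S = R := by rw [primesProd, hRdef, Nat.radical_eq_prod_primeFactors]
  have hunitS : ∀ t : ℤ, t ≠ 0 → t.natAbs ∣ (m * n).natAbs → IsSUnit S (t : ℚ) := by
    intro t ht hdvd
    refine ⟨by exact_mod_cast ht, ?_, ?_⟩
    · rw [Rat.num_intCast]; exact Nat.primeFactors_mono hdvd hmn0
    · simp
  have hmS : IsSUnit S (m : ℚ) := hunitS m hm0 (by rw [Int.natAbs_mul]; exact dvd_mul_right _ _)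
  have hnS : IsSUnit S (n : ℚ) := hunitS n hn0 (by rw [Int.natAbs_mul]; exact dvd_mul_left _ _)
  -- coprimality: no prime power divides both
  have hnodvd : ∀ k : ℕ, 1 ≤ k → ∀ p : ℕ, p.Prime → ¬ ((p : ℤ) ^ k ∣ m ∧ (p : ℤ) ^ k ∣ n) := by
    rintro k hk p hp ⟨hpm, hpn⟩
    have h1 : (p : ℤ) ∣ m := (dvd_pow_self _ (by omega)).trans hpm
    have h2 : (p : ℤ) ∣ n := (dvd_pow_self _ (by omega)).trans hpn
    have hu : IsUnit (p : ℤ) := hcop.isUnit_of_dvd' h1 h2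
    rcases Int.isUnit_iff.mp hu with h | h
    · exact hp.one_lt.ne' (by exact_mod_cast h)
    · have : (0 : ℤ) ≤ p := by positivity
      linarith
  -- the bound `Ω' ≤ (90 r)² log(9 r)`
  have hΩ : 3 * omegaSim S 1 + 9 * Real.log (primesProd S) ≤ (90 * r) ^ 2 * Real.log (9 * r) := by
    have hA : ((mordellLevel S 1 : ℕ) : ℝ) = 1728 * r ^ 2 := by
      rw [mordellLevel_one, hNS, hrdef]; push_cast; ring
    rw [omegaSim, logHeight₁_one, hA, hNS]
    have := numeric_corollary_L hr2
    rw [hrdef] at this ⊢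
    linarith
  -- `log|t| ≤ h(t)` for `t ≠ 0`
  have hlogle : ∀ t : ℤ, t ≠ 0 → Real.log |(t : ℝ)| ≤ logHeight₁ (t : ℚ) := by
    intro t ht
    rw [Rat.logHeight₁_eq_log_max]
    have h1 : 1 ≤ t.natAbs := Nat.one_le_iff_ne_zero.mpr (Int.natAbs_ne_zero.mpr ht)
    simp [max_eq_left h1, Nat.cast_natAbs, Int.cast_abs]
  constructor
  · -- squares
    rintro ⟨k, hk⟩
    have hl : k ^ 2 = m + n := by rw [hk]; ring
    have hsf := hnodvd 2 (by norm_num)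
    have h1 := claimsquare h91 hS hmS hnS hl hsf
    have h2 := claimsquare h91 hS hnS hmS (by rw [hl, add_comm]) fun p hp h => hsf p hp ⟨h.2, h.1⟩
    rcases hhyp with h | h
    · linarith [hlogle m hm0]
    · linarith [hlogle n hn0]
  · -- cubes
    rintro ⟨k, hk⟩
    have hl : k ^ 3 = m + n := hk.symm
    have hcf := hnodvd 3 (by norm_num)
    have h1 := claimcube hMo hS hmS hnS hl hcf
    have h2 := claimcube hMo hS hnS hmS (by rw [hl, add_comm]) fun p hp h => hcf p hp ⟨h.2, h.1⟩
    rcases hhyp with h | h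
    · linarith [hlogle m hm0]
    · linarith [hlogle n hn0]

/-- **vKM Corollary L ⟸ {modularity, Lemma 10.3, Prop. 10.8 (i)}** (through `corollary_9_1_sim_of_roots` and
`mordell_height_le_of_lemma_10_3_of_prop_10_8_i`); the named fact `corollary_L` is no longer an independent
root. [cite: VonkanelMatschke2023, Corollary L (§1.2.3; proof in §9)] -/
theorem corollary_L_of_roots (hmod : nonempty_modularParametrizationData)
    (h103 : vonKanelMatschke_lemma_10_3) (hi : vonKanelMatschke_prop_10_8_i) : corollary_L :=
  corollary_L_of_claims (corollary_9_1_sim_of_roots hmod h103 hi)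
    (mordell_height_le_of_lemma_10_3_of_prop_10_8_i hmod h103 hi)

end VonKanelMatschke

end Literature.NumberTheory.DiophantineGeometry

end
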